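import Mathlib
import Summits.QuantumAdvantage.QuantumAdvantage.Theses.MobiusLadder
import Summits.QuantumAdvantage.QuantumAdvantage.Theorems.MobiusLadderDigitPolyUniformityMRTAligned
import Summits.QuantumAdvantage.QuantumAdvantage.Theorems.MobiusLadderDigitPolyUniformityMRTFourierLowDigits
import Summits.QuantumAdvantage.QuantumAdvantage.Theorems.MobiusLadderDigitPolyUniformityMRTRegroupBlocks
import Summits.QuantumAdvantage.QuantumAdvantage.Theorems.MobiusLadderDigitPolyUniformityMRTEvalEnds
import HarnessLib

/-!
# Crux `DigitPolyUniformity` (stmt-QuantumAdvantage-1392), line `Sketch` — cycle 5: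
# the MATOMÄKI–RADZIWIŁŁ–TAO CLASSES of the crux, unconditionally

The crux asks, for every `A` and `ε > 0`, eventually in `n`, `|Σ_{N<2ⁿ} λ(N)(−1)^{P(bits N)}| ≤ ε 2ⁿ` for every
`P ∈ 𝔽₂[x_0..x_{n−1}]` of degree `≤ (log₂ n)^A`. This file settles it, with NO degree restriction, for every `P`
avoiding a window of low digits: from the tree's PROVED Matomäki–Radziwiłł–Tao 2015 Theorem 1.3
(`Literature.NumberTheory.LFunctions.Tao2016.MatomakiRadziwillTao2015_theorem13_holds`, transferred to
aligned dyadic blocks by the registered stub `stub_alignedMRT`, `Theorems/…MRTAligned`):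

* `liouville_twoEnds_weight_le` — for every `C`, `ε` there is a depth `h₀` with, eventually in `n`, for all
  `h₀ ≤ h ≤ n/2` and every `1`-bounded `g : ℕ → ℕ → ℂ`: `‖Σ_{N<2ⁿ} λ(N) g(N mod 2^C, ⌊N/2^h⌋)‖ ≤ ε 2ⁿ`
  (finite Fourier expansion in the low `C` digits, `stub_fourier_lowDigits`; regrouping `stub_regroup_blocks`);
  real forms `liouville_twoEnds_weight_le_real`, `liouville_topDigits_weight_le_real`, and the aligned
  short-block statement `liouville_aligned_blocks_le` (`Σ_y |Σ_{block y} λ| ≤ ε2ⁿ`, the `S_y = ∅` instance of the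
  short-interval Walsh statement of `Theorems/…LowAffine`);
* `digitPolyUniformity_twoEnds` — THE CRUX FOR THE TWO-ENDS CLASS: for every `C` and `ε` a FIXED depth `h₀` such
  that, eventually, every `P` in the variables `{x_i : i < C} ∪ {x_i : i ≥ h₀}` (any degree, any support) has
  correlation `≤ ε` (`stub_eval_eq_of_vars_ends`); growing-depth form `digitPolyUniformity_twoEnds_of_tendsto`;
* `digitPolyUniformity_topDigits` — THE CRUX FOR THE TOP-DIGIT CLASS (`C = 0`): a fixed depth `h₀(ε)` beyond which
  EVERY polynomial in `x_{h₀}, …, x_{n−1}` is `ε`-orthogonal to `λ`; growing-depth form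
  `digitPolyUniformity_topDigits_of_tendsto` (every `P ∈ 𝔽₂[x_{d(n)}, …, x_{n−1}]`, `d(n) → ∞` arbitrarily slowly).

Position among the known classes (all in `Theorems/MobiusLadderDigitPolyUniformity*.lean`): line 0's `stub_ends`
(functions of `k` low and `m` top digits, `(k+m)^3 ≤ n`, from Green's characters mod `2^t`) is incomparable —
stronger at the bottom (`k ≍ n^{1/3}`), far weaker at the top (`m ≍ n^{1/3}` against `m = n − h₀` here);
`digitPolyUniformity_few_vars` (`≤ (log₂ n)^A` variables), `…_sparse`, `…_affine_products` are ℓ¹-Walsh-structured,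
whereas the classes here allow flat Walsh spectrum and `2^{n−h₀}` monomials in the high digits. What they cannot
touch is a variable in the low window `[C, h₀(ε, C))`: the short-interval scale below which Matomäki–Radziwiłł-type
averages are blind ("sup inside" over Walsh packets of the low digits = `SIW(h)`, seat c4's dossier §3), which is
where the bent/mirror regime of stmt-1391 lives.

All statements are in the crux's own vocabulary; no unproved fact is used.
-/

noncomputable section

namespace Summit.QuantumAdvantage.DigitPolyUniformity.SketchLAR

open Filter Finset
open Literature.NumberTheory.LFunctions

/-- **Two-ends weights (complex form).** For every `C` and `ε > 0` there is a depth `h₀` such that,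
eventually in `n`, for every `h₀ ≤ h ≤ n/2` and every `1`-bounded weight `g`,
`‖Σ_{N<2ⁿ} λ(N) g(N mod 2^C, ⌊N/2^h⌋)‖ ≤ ε 2ⁿ`: the Liouville function is orthogonal to every function of the
`C` lowest and the `n − h` highest binary digits. Finite Fourier expansion in the low digits
(`stub_fourier_lowDigits`, `2^C` linear phases `e(aN/2^C)`), regrouping over aligned blocks
(`stub_regroup_blocks`) and the aligned Matomäki–Radziwiłł–Tao bound (`stub_alignedMRT`) at `α = a/2^C` with
`ε/2^C`. [cite: MatomakiRadziwillTao2015, Theorem 1.3] -/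
theorem liouville_twoEnds_weight_le :
    ∀ C : ℕ, ∀ ε : ℝ, 0 < ε → ∃ h₀ : ℕ, ∀ᶠ n : ℕ in atTop, ∀ h : ℕ, h₀ ≤ h → 2 * h ≤ n →
      ∀ g : ℕ → ℕ → ℂ, (∀ r y, ‖g r y‖ ≤ 1) →
        ‖∑ N ∈ range (2 ^ n), ((ArithmeticFunction.liouville N : ℤ) : ℂ) * g (N % 2 ^ C) (N / 2 ^ h)‖ ≤
          ε * 2 ^ n := by
  intro C ε hε
  obtain ⟨h₀, hh₀⟩ := stub_alignedMRT (ε / 2 ^ C) (by positivity)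
  refine ⟨h₀, ?_⟩
  filter_upwards [hh₀] with n hn h hh0h h2n g hg
  -- Fourier-expand `g(·, y)` for each `y`
  have hF : ∀ y : ℕ, ∃ c : ℕ → ℂ, (∀ a, ‖c a‖ ≤ 1) ∧ ∀ N : ℕ, g (N % 2 ^ C) y =
      ∑ a ∈ range (2 ^ C), c a * VdC.e ((a : ℝ) * N / 2 ^ C) :=
    fun y => stub_fourier_lowDigits C (fun r => g r y) (fun r => hg r y)
  choose c hc1 hc2 using hF
  -- exchange the sums
  have hsum : ∑ N ∈ range (2 ^ n), ((ArithmeticFunction.liouville N : ℤ) : ℂ) * g (N % 2 ^ C) (N / 2 ^ h) =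
      ∑ a ∈ range (2 ^ C), ∑ N ∈ range (2 ^ n),
        (((ArithmeticFunction.liouville N : ℤ) : ℂ) * VdC.e ((a : ℝ) / 2 ^ C * N)) * c (N / 2 ^ h) a := by
    rw [Finset.sum_comm]
    refine Finset.sum_congr rfl fun N _ => ?_
    rw [hc2 (N / 2 ^ h) N, Finset.mul_sum]
    refine Finset.sum_congr rfl fun a _ => ?_
    rw [div_mul_eq_mul_div]
    ring
  rw [hsum]
  refine (norm_sum_le _ _).trans ?_
  have hn' : h + (n - h) = n := by omega
  have key : ∀ a ∈ range (2 ^ C), ‖∑ N ∈ range (2 ^ n),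
      (((ArithmeticFunction.liouville N : ℤ) : ℂ) * VdC.e ((a : ℝ) / 2 ^ C * N)) * c (N / 2 ^ h) a‖ ≤
      ε / 2 ^ C * 2 ^ n := by
    intro a _
    have hreg := stub_regroup_blocks
      (fun N : ℕ => ((ArithmeticFunction.liouville N : ℤ) : ℂ) * VdC.e ((a : ℝ) / 2 ^ C * N))
      (fun y => c y a) (fun y => hc1 y a) h (n - h)
    rw [hn'] at hreg
    refine hreg.trans ?_
    exact hn h hh0h h2n ((a : ℝ) / 2 ^ C)
  calc ∑ a ∈ range (2 ^ C), ‖∑ N ∈ range (2 ^ n),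
        (((ArithmeticFunction.liouville N : ℤ) : ℂ) * VdC.e ((a : ℝ) / 2 ^ C * N)) * c (N / 2 ^ h) a‖
      ≤ ∑ a ∈ range (2 ^ C), ε / 2 ^ C * 2 ^ n := Finset.sum_le_sum key
    _ = ε * 2 ^ n := by
      rw [Finset.sum_const, Finset.card_range, nsmul_eq_mul]
      push_cast
      field_simp

/-- The digital phase `(−1)^{[P(bits N) = 1]}` has absolute value `≤ 1`. [folklore] -/
theorem abs_phase_le_one {n : ℕ} (P : MvPolynomial (Fin n) (ZMod 2)) (N : ℕ) :
    |(if MvPolynomial.eval (fun i : Fin n => if Nat.testBit N i then (1 : ZMod 2) else 0) P = 1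
        then (-1 : ℝ) else 1)| ≤ 1 := by
  split_ifs <;> simp

/-- **The crux for the two-ends class, unconditionally.** For every `C` and `ε > 0` there is a FIXED depth
`h₀` such that, eventually in `n`, every `P ∈ 𝔽₂[x_0..x_{n−1}]` all of whose variables are among
`x_0, …, x_{C−1}` (the `C` lowest digits) and `x_{h₀}, x_{h₀+1}, …, x_{n−1}` (all digits from depth `h₀` on) — of ANY
degree and ANY number of monomials — has `|Σ_{N<2ⁿ} λ(N)(−1)^{P(bits N)}| ≤ ε 2ⁿ`. (`P(bits N)` is then a function
of `(N mod 2^C, ⌊N/2^{h₀}⌋)` by `stub_eval_eq_of_vars_ends`; apply `liouville_twoEnds_weight_le`.) What the class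
cannot contain is a variable in the window `[C, h₀(ε, C))` of low digits — the short-interval scale below which
Matomäki–Radziwiłł-type theorems are blind. [cite: MatomakiRadziwillTao2015, Theorem 1.3] -/
theorem digitPolyUniformity_twoEnds :
    ∀ C : ℕ, ∀ ε : ℝ, 0 < ε → ∃ h₀ : ℕ, ∀ᶠ n : ℕ in atTop, ∀ P : MvPolynomial (Fin n) (ZMod 2),
      (∀ i ∈ P.vars, (i : ℕ) < C ∨ h₀ ≤ (i : ℕ)) →
      |∑ N ∈ range (2 ^ n), ((ArithmeticFunction.liouville N : ℤ) : ℝ) *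
          (if MvPolynomial.eval (fun i : Fin n => if Nat.testBit N i then (1 : ZMod 2) else 0) P = 1
            then (-1 : ℝ) else 1)| ≤ ε * (2 : ℝ) ^ n := by
  intro C ε hε
  obtain ⟨h₀, hh₀⟩ := liouville_twoEnds_weight_le C ε hε
  refine ⟨max h₀ C, ?_⟩
  filter_upwards [hh₀, eventually_ge_atTop (2 * max h₀ C)] with n hn hn2 P hP
  set h₁ : ℕ := max h₀ C with hh₁def
  -- the phase as a function of `N`
  set s : ℕ → ℝ := fun N =>
    (if MvPolynomial.eval (fun i : Fin n => if Nat.testBit N i then (1 : ZMod 2) else 0) P = 1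
      then (-1 : ℝ) else 1) with hsdef
  have hs1 : ∀ N, |s N| ≤ 1 := fun N => abs_phase_le_one P N
  -- `s N` depends only on `(N % 2^C, N / 2^{h₁})`
  have hC1 : 2 ^ C ∣ 2 ^ h₁ := pow_dvd_pow 2 (le_max_right _ _)
  have hloc : ∀ N : ℕ, s N = s (2 ^ h₁ * (N / 2 ^ h₁) + N % 2 ^ C) := by
    intro N
    have hlow : N % 2 ^ C = (2 ^ h₁ * (N / 2 ^ h₁) + N % 2 ^ C) % 2 ^ C := by
      obtain ⟨k, hk⟩ := hC1
      rw [hk, mul_assoc, Nat.mul_add_mod, Nat.mod_mod]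
    have hlt : N % 2 ^ C < 2 ^ h₁ :=
      lt_of_lt_of_le (Nat.mod_lt _ (by positivity)) (Nat.pow_le_pow_right (by norm_num) (le_max_right _ _))
    have hhigh : N / 2 ^ h₁ = (2 ^ h₁ * (N / 2 ^ h₁) + N % 2 ^ C) / 2 ^ h₁ := by
      rw [Nat.mul_add_div (by positivity), Nat.div_eq_of_lt hlt, add_zero]
    simp only [hsdef]
    rw [stub_eval_eq_of_vars_ends P C h₁ hP hlow hhigh]
  -- the weight `g`
  set g : ℕ → ℕ → ℂ := fun r y => (s (2 ^ h₁ * y + r) : ℂ) with hgdef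
  have hg : ∀ r y, ‖g r y‖ ≤ 1 := by
    intro r y
    rw [hgdef]; dsimp only
    rw [Complex.norm_real, Real.norm_eq_abs]
    exact hs1 _
  have hmain := hn h₁ (le_max_left _ _) hn2 g hg
  -- transfer to the real sum
  have hcast : ((∑ N ∈ range (2 ^ n), ((ArithmeticFunction.liouville N : ℤ) : ℝ) * s N : ℝ) : ℂ) =
      ∑ N ∈ range (2 ^ n), ((ArithmeticFunction.liouville N : ℤ) : ℂ) * g (N % 2 ^ C) (N / 2 ^ h₁) := by
    push_cast
    refine Finset.sum_congr rfl fun N _ => ?_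
    rw [hgdef]; dsimp only
    rw [← hloc N]
  rw [← Real.norm_eq_abs, ← Complex.norm_real, hcast]
  exact hmain

/-- **The crux for the top-digit class, unconditionally** (`C = 0` in `digitPolyUniformity_twoEnds`): for every
`ε > 0` there is a FIXED depth `h₀ = h₀(ε)` such that, eventually in `n`, EVERY `P ∈ 𝔽₂[x_{h₀}, …, x_{n−1}]` (any
degree; every digital phase that ignores the `h₀` lowest binary digits) has `|Σ_{N<2ⁿ} λ(N)(−1)^{P(bits N)}| ≤ ε 2ⁿ`
— "the Liouville function has no structure in its leading `n − h₀` digits". [cite: MatomakiRadziwillTao2015, Theorem 1.3] -/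
theorem digitPolyUniformity_topDigits :
    ∀ ε : ℝ, 0 < ε → ∃ h₀ : ℕ, ∀ᶠ n : ℕ in atTop, ∀ P : MvPolynomial (Fin n) (ZMod 2),
      (∀ i ∈ P.vars, h₀ ≤ (i : ℕ)) →
      |∑ N ∈ range (2 ^ n), ((ArithmeticFunction.liouville N : ℤ) : ℝ) *
          (if MvPolynomial.eval (fun i : Fin n => if Nat.testBit N i then (1 : ZMod 2) else 0) P = 1
            then (-1 : ℝ) else 1)| ≤ ε * (2 : ℝ) ^ n := by
  intro ε hε
  obtain ⟨h₀, hh₀⟩ := digitPolyUniformity_twoEnds 0 ε hε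
  refine ⟨h₀, ?_⟩
  filter_upwards [hh₀] with n hn P hP
  exact hn P fun i hi => Or.inr (hP i hi)

/-- **Top-digit class, growing-depth form**: for any depth function `d(n) → ∞`, for every `ε > 0`, eventually in
`n`, every `P` in the variables `x_{d(n)}, …, x_{n−1}` has correlation `≤ ε` with `λ`. [cite: MatomakiRadziwillTao2015, Theorem 1.3] -/
theorem digitPolyUniformity_topDigits_of_tendsto (d : ℕ → ℕ)
    (hd : Tendsto d atTop atTop) :
    ∀ ε : ℝ, 0 < ε → ∀ᶠ n : ℕ in atTop, ∀ P : MvPolynomial (Fin n) (ZMod 2),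
      (∀ i ∈ P.vars, d n ≤ (i : ℕ)) →
      |∑ N ∈ range (2 ^ n), ((ArithmeticFunction.liouville N : ℤ) : ℝ) *
          (if MvPolynomial.eval (fun i : Fin n => if Nat.testBit N i then (1 : ZMod 2) else 0) P = 1
            then (-1 : ℝ) else 1)| ≤ ε * (2 : ℝ) ^ n := by
  intro ε hε
  obtain ⟨h₀, hh₀⟩ := digitPolyUniformity_topDigits ε hε
  filter_upwards [hh₀, hd.eventually_ge_atTop h₀] with n hn hdn P hP
  exact hn P fun i hi => hdn.trans (hP i hi)

/-- **Two-ends class, growing-depth form**: for `C` fixed and any `d(n) → ∞`, for every `ε > 0`, eventually in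
`n`, every `P` in the variables `{x_i : i < C} ∪ {x_i : i ≥ d(n)}` has correlation `≤ ε` with `λ`.
[cite: MatomakiRadziwillTao2015, Theorem 1.3] -/
theorem digitPolyUniformity_twoEnds_of_tendsto (C : ℕ) (d : ℕ → ℕ)
    (hd : Tendsto d atTop atTop) :
    ∀ ε : ℝ, 0 < ε → ∀ᶠ n : ℕ in atTop, ∀ P : MvPolynomial (Fin n) (ZMod 2),
      (∀ i ∈ P.vars, (i : ℕ) < C ∨ d n ≤ (i : ℕ)) →
      |∑ N ∈ range (2 ^ n), ((ArithmeticFunction.liouville N : ℤ) : ℝ) *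
          (if MvPolynomial.eval (fun i : Fin n => if Nat.testBit N i then (1 : ZMod 2) else 0) P = 1
            then (-1 : ℝ) else 1)| ≤ ε * (2 : ℝ) ^ n := by
  intro ε hε
  obtain ⟨h₀, hh₀⟩ := digitPolyUniformity_twoEnds C ε hε
  filter_upwards [hh₀, hd.eventually_ge_atTop h₀] with n hn hdn P hP
  exact hn P fun i hi => (hP i hi).imp_right hdn.trans

/-- **Two-ends weights (real form; compare line 0's `stub_ends`, depths `(k+m)^3 ≤ n`):** for every `C` and
`ε > 0` there is `h₀` such that, eventually in `n`, for all `h₀ ≤ h ≤ n/2` and every `1`-bounded real `g`,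
`|Σ_{N<2ⁿ} λ(N) g(N mod 2^C, ⌊N/2^h⌋)| ≤ ε 2ⁿ` — bounded bottom depth, UNBOUNDED top depth `n − h`.
[cite: MatomakiRadziwillTao2015, Theorem 1.3] -/
theorem liouville_twoEnds_weight_le_real :
    ∀ C : ℕ, ∀ ε : ℝ, 0 < ε → ∃ h₀ : ℕ, ∀ᶠ n : ℕ in atTop, ∀ h : ℕ, h₀ ≤ h → 2 * h ≤ n →
      ∀ g : ℕ → ℕ → ℝ, (∀ r y, |g r y| ≤ 1) →
        |∑ N ∈ range (2 ^ n), (ArithmeticFunction.liouville N : ℝ) * g (N % 2 ^ C) (N / 2 ^ h)| ≤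
          ε * 2 ^ n := by
  intro C ε hε
  obtain ⟨h₀, hh₀⟩ := liouville_twoEnds_weight_le C ε hε
  refine ⟨h₀, ?_⟩
  filter_upwards [hh₀] with n hn h hh0h h2n g hg
  have hg' : ∀ r y, ‖((g r y : ℝ) : ℂ)‖ ≤ 1 := fun r y => by
    rw [Complex.norm_real, Real.norm_eq_abs]; exact hg r y
  have := hn h hh0h h2n (fun r y => (g r y : ℂ)) hg'
  have hcast : ((∑ N ∈ range (2 ^ n), (ArithmeticFunction.liouville N : ℝ) * g (N % 2 ^ C) (N / 2 ^ h) : ℝ) : ℂ)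
      = ∑ N ∈ range (2 ^ n), ((ArithmeticFunction.liouville N : ℤ) : ℂ) * (g (N % 2 ^ C) (N / 2 ^ h) : ℂ) := by
    push_cast; rfl
  rw [← Real.norm_eq_abs, ← Complex.norm_real, hcast]
  exact this

/-- **Top-digit weights (real form):** for every `ε > 0` there is `h₀` such that, eventually in `n`, for all
`h₀ ≤ h ≤ n/2` and every `1`-bounded real `w`, `|Σ_{N<2ⁿ} λ(N) w(⌊N/2^h⌋)| ≤ ε 2ⁿ` (Matomäki–Radziwiłł in digital
clothing: `λ` is orthogonal to every function of `⌊N/H⌋`, `H = 2^h ≥ 2^{h₀}`). [cite: MatomakiRadziwillTao2015, Theorem 1.3] -/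
theorem liouville_topDigits_weight_le_real :
    ∀ ε : ℝ, 0 < ε → ∃ h₀ : ℕ, ∀ᶠ n : ℕ in atTop, ∀ h : ℕ, h₀ ≤ h → 2 * h ≤ n →
      ∀ w : ℕ → ℝ, (∀ y, |w y| ≤ 1) →
        |∑ N ∈ range (2 ^ n), (ArithmeticFunction.liouville N : ℝ) * w (N / 2 ^ h)| ≤ ε * 2 ^ n := by
  intro ε hε
  obtain ⟨h₀, hh₀⟩ := liouville_twoEnds_weight_le_real 0 ε hε
  refine ⟨h₀, ?_⟩
  filter_upwards [hh₀] with n hn h hh0h h2n w hw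
  exact hn h hh0h h2n (fun _ y => w y) (fun _ y => hw y)

/-- **Aligned short blocks (real form):** for every `ε > 0` there is `h₀` such that, eventually in `n`, for all
`h₀ ≤ h ≤ n/2`, `Σ_{y<2^{n−h}} |Σ_{x<2^h} λ(2^h y + x)| ≤ ε 2ⁿ` — the instance `S_y = ∅` (no Walsh twist) of the
short-interval Walsh statement `SIW(h)` of `Theorems/…LowAffine` (`digitPolyUniformity_lowAffine_of_shortWalsh`),
now unconditional at every depth `h ≥ h₀(ε)`. [cite: MatomakiRadziwillTao2015, Theorem 1.3] -/
theorem liouville_aligned_blocks_le :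
    ∀ ε : ℝ, 0 < ε → ∃ h₀ : ℕ, ∀ᶠ n : ℕ in atTop, ∀ h : ℕ, h₀ ≤ h → 2 * h ≤ n →
      ∑ y ∈ range (2 ^ (n - h)), |∑ x ∈ range (2 ^ h),
        (ArithmeticFunction.liouville (2 ^ h * y + x) : ℝ)| ≤ ε * 2 ^ n := by
  intro ε hε
  obtain ⟨h₀, hh₀⟩ := stub_alignedMRT ε hε
  refine ⟨h₀, ?_⟩
  filter_upwards [hh₀] with n hn h hh0h h2n
  have := hn h hh0h h2n 0
  simp only [zero_mul, VdC.e_zero, mul_one] at this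
  refine le_trans (le_of_eq ?_) this
  refine Finset.sum_congr rfl fun y _ => ?_
  rw [← Real.norm_eq_abs, ← Complex.norm_real]
  push_cast
  rfl

end Summit.QuantumAdvantage.DigitPolyUniformity.SketchLAR

end
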